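import Literature.AlgebraicGeometry.ShimuraVarieties.UnitaryBallPoincareImmersion
import HarnessLib

/-!
# Poincaré series on `𝔹²` are holomorphic automorphic forms — lattice-sum form

Companion of `UnitaryBallPoincareImmersion.lean` / `UnitaryBallPoincareSeparationOfLatticeSum.lean`. Let
`ρ : Γ → U(2,1)` act on the ball `𝔹² ⊂ ℂ²` (the tree's `BallModel.Ball`, canonical automorphy factor
`J(g, z) = BallForms.canonicalFactor g z`, cocycle `BallForms.canonicalCocycle ℂ k : (g, z) ↦ J(g,z)ᵏ • ·`).
For a function `φ` on the ball the Poincaré series of weight `k` is written, as in the sibling files,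
literally `P_k φ = fun z ↦ ∑' γ, J(ρ γ, z)ᵏ φ(ρ γ • z)`. We PROVE:

* `poincareSeries_mem_factorForms_of_latticeSum` — **automorphy** (no convergence needed: Lean's `∑'`
  is reindexing-invariant): `P_k φ ∈ factorForms ρ(Γ) (canonicalCocycle ℂ k)`, i.e.
  `P_k φ (z) = J(δ, z)ᵏ · P_k φ (δ z)` for `δ ∈ ρ(Γ)` — the cocycle identity
  `J(γ δ, z) = J(δ, z) J(γ, δ z)` (`BallForms.canonicalFactor_mul`) and the reindexing `γ ↦ γ γ₀`;
* `poincareSeries_mem_holomorphic_of_latticeSum` — **holomorphy**: if the lattice sums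
  `∑_γ ‖(ρ γ)₂₂‖⁻ⁿ` (`n ≥ 6`) converge, `k ≥ 2`, and `φ` is holomorphic with `|φ| ≤ B`, `‖Dφ̃‖ ≤ B'` on the
  ball, then `P_k φ ∈ BallForms.holomorphic ℂ` (termwise differentiability at every point of the ball is the
  tree's `BallPoincare.hasFDerivAt_extend_poincareSeries`);
* `poincareSeries_mem_holFactorForms_of_latticeSum` — hence `P_k φ ∈ holFactorForms ρ(Γ) (canonicalCocycle ℂ k)`,
  and the subgroup form `poincareSeries_mem_holFactorForms_of_latticeSum_subgroup` for `Δ ≤ U(2,1)`,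
  `ρ := Δ.subtype` (membership in `holFactorForms Δ (canonicalCocycle ℂ k)`, spelt with `(γ : U21)`).

These are Shafarevich's "the Poincaré series are automorphic forms of weight `k`" (*Basic Algebraic
Geometry 2*, Ch. IX §3.1, after the Proposition) with the discreteness input in LATTICE-SUM form
(hypothesis `hS`; it is `BallPoincare.summable_inv_norm_22_pow` of `UnitaryBallPoincareSeries.lean` for every
`ρ` with finite corner sets, in particular for properly discontinuous subgroups,
`BallModel.finite_setOf_norm_22_subtype_le`), so that this file imports only `UnitaryBallPoincareImmersion`.

References: I. R. Shafarevich, *Basic Algebraic Geometry 2* (Springer 1994), Book 3, Ch. IX §3.1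
(Proposition and the paragraph following it), §3.2; A. Borel, *Automorphic forms on `SL₂(ℝ)`* (1997),
§5.14 (the cocycle dictionary). Everything here is PROVED; theorems only.

## Provenance

pub-hodgecm2 cell (COR-CM), LIT-FANOUT row D4 (b1) in lattice-sum form (the `_of_latticeSum` family written
as insurance for the h₁ junction `compactBallQuotient_projectiveEmbedding_holds`); the corner-finiteness
form of the same statements is the cell's `UnitaryBallPoincareForms.lean`.
-/

set_option autoImplicit false

noncomputable section

open Matrix Set Filter Topology
open Literature.Geometry.ComplexHyperbolic
open Literature.Geometry.ComplexHyperbolic.BallModel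
open Literature.NumberTheory.Automorphic.AutomorphyFactor

namespace Literature.AlgebraicGeometry.ShimuraVarieties

namespace BallPoincare

open BallForms

section Forms

variable {G : Type*} [Group G] (ρ : G →* U21)

/-- **Automorphy of the Poincaré series** (any weight `k`, any `φ`; `∑'` is invariant under the
reindexing `γ ↦ γ γ₀`): `P_k φ (z) = J(ρ γ₀, z)ᵏ · P_k φ (ρ γ₀ z)`, i.e. `P_k φ` is a `ρ(Γ)`-automorphic
function for the canonical cocycle of weight `k`. [cite: Shafarevich1994, Ch. IX §3.1 (after the Proposition)] -/
theorem poincareSeries_mem_factorForms_of_latticeSum (k : ℕ) (φ : Ball → ℂ) :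
    (fun z ↦ ∑' γ : G, canonicalFactor (ρ γ) z ^ k * φ (ρ γ • z)) ∈
      factorForms ρ.range (canonicalCocycle ℂ k) := by
  rw [canonicalCocycle, mem_factorForms_scalarCocycle_iff]
  rintro _ ⟨γ₀, rfl⟩ z
  simp only [smul_eq_mul]
  rw [← tsum_mul_left, ← (Equiv.mulRight γ₀).tsum_eq fun γ ↦
    canonicalFactor (ρ γ) z ^ k * φ (ρ γ • z)]
  refine tsum_congr fun γ ↦ ?_
  simp only [Equiv.coe_mulRight, map_mul, mul_smul, canonicalFactor_mul, mul_pow]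
  ring

/-- **Holomorphy of the Poincaré series** of weight `k ≥ 2` built on a bounded holomorphic `φ` with
bounded derivative, under convergence of the lattice sums `∑_γ ‖(ρ γ)₂₂‖⁻ⁿ` (`n ≥ 6`): the zero extension
is complex differentiable at every point of the ball (termwise differentiation,
`hasFDerivAt_extend_poincareSeries`). [cite: Shafarevich1994, Ch. IX §3.1, Proposition] -/
theorem poincareSeries_mem_holomorphic_of_latticeSum
    (hS : ∀ n : ℕ, 6 ≤ n → Summable fun γ : G ↦ (‖mat (ρ γ) 2 2‖ ^ n)⁻¹)
    {k : ℕ} (hk : 2 ≤ k) {φ : Ball → ℂ} (hφh : φ ∈ holomorphic ℂ) {B B' : ℝ}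
    (hφ : ∀ z, ‖φ z‖ ≤ B) (hφ' : ∀ z : Ball, ‖fderiv ℂ (extend ℂ φ) z.1‖ ≤ B') :
    (fun z ↦ ∑' γ : G, canonicalFactor (ρ γ) z ^ k * φ (ρ γ • z)) ∈ holomorphic ℂ := by
  rw [mem_holomorphic_iff]
  intro y hy
  exact (hasFDerivAt_extend_poincareSeries ρ hS hk hφh hφ hφ' ⟨y, hy⟩).differentiableAt
    |>.differentiableWithinAt

/-- **Poincaré series are holomorphic automorphic forms** of weight `k ≥ 2` for the canonical cocycle
(`holFactorForms ρ(Γ) (canonicalCocycle ℂ k)`), for bounded holomorphic `φ` with bounded derivative, under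
convergence of the lattice sums. [cite: Shafarevich1994, Ch. IX §3.1, Proposition] -/
theorem poincareSeries_mem_holFactorForms_of_latticeSum
    (hS : ∀ n : ℕ, 6 ≤ n → Summable fun γ : G ↦ (‖mat (ρ γ) 2 2‖ ^ n)⁻¹)
    {k : ℕ} (hk : 2 ≤ k) {φ : Ball → ℂ} (hφh : φ ∈ holomorphic ℂ) {B B' : ℝ}
    (hφ : ∀ z, ‖φ z‖ ≤ B) (hφ' : ∀ z : Ball, ‖fderiv ℂ (extend ℂ φ) z.1‖ ≤ B') :
    (fun z ↦ ∑' γ : G, canonicalFactor (ρ γ) z ^ k * φ (ρ γ • z)) ∈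
      holFactorForms ρ.range (canonicalCocycle ℂ k) :=
  mem_holFactorForms_iff.2 ⟨poincareSeries_mem_factorForms_of_latticeSum ρ k φ,
    poincareSeries_mem_holomorphic_of_latticeSum ρ hS hk hφh hφ hφ'⟩

end Forms

/-! ### The subgroup form -/

section Subgroup

variable (Δ : Subgroup U21)

/-- **Poincaré series of a subgroup `Δ ≤ U(2,1)` are holomorphic automorphic forms for `Δ`**
(`holFactorForms Δ (canonicalCocycle ℂ k)`, weight `k ≥ 2`, bounded holomorphic `φ` with bounded
derivative, convergent lattice sums `∑_δ ‖δ₂₂‖⁻ⁿ`, `n ≥ 6`) — the `ρ := Δ.subtype` instance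
(`Δ.subtype.range = Δ`). [cite: Shafarevich1994, Ch. IX §3.1, Proposition] -/
theorem poincareSeries_mem_holFactorForms_of_latticeSum_subgroup
    (hS : ∀ n : ℕ, 6 ≤ n → Summable fun γ : Δ ↦ (‖mat (γ : U21) 2 2‖ ^ n)⁻¹)
    {k : ℕ} (hk : 2 ≤ k) {φ : Ball → ℂ} (hφh : φ ∈ holomorphic ℂ) {B B' : ℝ}
    (hφ : ∀ z, ‖φ z‖ ≤ B) (hφ' : ∀ z : Ball, ‖fderiv ℂ (extend ℂ φ) z.1‖ ≤ B') :
    (fun z ↦ ∑' γ : Δ, canonicalFactor (γ : U21) z ^ k * φ ((γ : U21) • z)) ∈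
      holFactorForms Δ (canonicalCocycle ℂ k) := by
  have h := poincareSeries_mem_holFactorForms_of_latticeSum Δ.subtype hS hk hφh hφ hφ'
  rwa [Subgroup.range_subtype] at h

end Subgroup

end BallPoincare

end Literature.AlgebraicGeometry.ShimuraVarieties

end
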